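import Literature.NumberTheory.Automorphic.AdelicUnitaryGroupMeasure
import HarnessLib

/-!
# Automorphic measures from a covering set of finite volume, for data with trivial split centre
# (the reduction-theory interface of the quasi-split unitary groups `U(Φ_N)`)

Topic `NumberTheory/Automorphic`; namespace `Literature.NumberTheory.Automorphic` (grouping
sub-namespaces `AdelicGroupData`, `UnitaryGroup`). Proof file: theorems only, no definition, no named
fact, no `sorry`; imports = tree + Mathlib.

The tree constructs automorphic measures (`AdelicGroupData.IsAutomorphicMeasure`: finite, positive on
non-empty open sets, inner regular, `G(𝔸_K)`-invariant Borel measures on `G(𝔸_K) ⧸ (A_G · G(K))`)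
* on COMPACT automorphic quotients (`exists_isAutomorphicMeasure_of_compactSpace`,
  `…_of_center'_eq_bot`, `UnitaryGroup.exists_isAutomorphicMeasure_cmDatum` for ANISOTROPIC hermitian
  forms), and
* from a COVERING SET OF FINITE VOLUME inside `G(𝔸_K)¹ = ker θ` of a central retraction `θ`
  (`exists_isAutomorphicMeasure_of_cover`, the shape of Borel–Harish-Chandra's theorem, Borel (1963)
  §5 Thm. 5.8, used for `GL_n` with a Siegel set).

This file is the second constructor SPECIALISED TO `A_G = ⊥` (no retraction, no `ker θ` plumbing):
for a datum with trivial split centre, discrete rational points and a locally compact second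
countable Hausdorff `G(𝔸_K)`, an automorphic measure exists as soon as
(i) the modular function of `G(𝔸_K)` is trivial on `G(K)` and (ii) some Borel set `C ⊆ G(𝔸_K)` of
finite Haar measure meets every coset `g · G(K)` —

* `AdelicGroupData.exists_isAutomorphicMeasure_of_cover_of_center'_eq_bot`, and the unimodular
  variant `…_of_cover_of_unimodular` (hypothesis (i) for every `g ∈ G(𝔸_K)`);
* `UnitaryGroup.exists_isAutomorphicMeasure_cmDatum_of_cover` — the same for the unitary group
  `U(H)(𝔸_{L⁺})` of ANY matrix `H ∈ M_N(L)` over a CM field `L` (datum `UnitaryGroup.cmDatum L N H`: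
  `A_G = ⊥`, `U(H)(L⁺)` discrete): this is the interface through which reduction theory for the
  QUASI-SPLIT (isotropic) unitary groups `U(Φ_N)` — a Siegel set of finite Haar measure covering
  `U(Φ_N)(L⁺)\U(Φ_N)(𝔸_{L⁺})` — yields their automorphic measures (Borel (1963) §5; Platonov–Rapinchuk
  (1994) Thm. 4.17 / §5.2 for the finiteness of the volume of `G_A/G_K`);
* the rank-`0` and definite instances that need no reduction theory:
  `UnitaryGroup.exists_isAutomorphicMeasure_cmDatum_zero` (`N = 0`) and
  `UnitaryGroup.exists_isAutomorphicMeasure_cmDatum_one` (`H = 1_N`, the definite unitary group, in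
  particular `U(1) = U(Φ₁)`).

## References

* A. Borel, *Some finiteness properties of adele groups over number fields*, Publ. Math. IHÉS 16
  (1963), §5 (Thm. 5.8: `G_A/G_k` has finite invariant measure; construction from a fundamental set
  of finite Haar measure). [Borel1963]
* V. Platonov, A. Rapinchuk, *Algebraic Groups and Number Theory* (1994), Thm. 4.17, §5.2–5.3.
  [PlatonovRapinchuk1994]
* M. S. Raghunathan, *Discrete subgroups of Lie groups* (1972), Ch. I, 1.4–1.9. [folklore]
-/

noncomputable section

open MeasureTheory Measure Topology NumberField
open scoped NNReal ENNReal ComplexOrder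

namespace Literature.NumberTheory.Automorphic

namespace AdelicGroupData

universe u

variable {K : Type} [Field K] [NumberField K]

/-- **Automorphic measure from a covering set of finite volume, for a datum with trivial split
centre.** Let `𝒢` be an adelic group datum with `A_G = ⊥`, `G(𝔸_K)` locally compact second countable
Hausdorff with a Borel σ-algebra, and `G(K)` discrete; assume the modular function of `G(𝔸_K)` is
trivial on `G(K)` and that some set `C ⊆ G(𝔸_K)` with `ν C < ∞` for a Haar measure `ν` meets every
coset of `G(K)`. Then the automorphic quotient `G(𝔸_K) ⧸ G(K)` carries an automorphic measure.
Proof: `A_G · G(K) = G(K)` is discrete, so `exists_smulInvariantMeasure_quotient_of_cover` gives a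
finite invariant open-positive inner-regular measure on `G(𝔸_K) ⧸ (A_G · G(K))`, transported to the
automorphic quotient (same space, Borel σ-algebra) along the identity homeomorphism. This is the
shape of Borel–Harish-Chandra's theorem with a Siegel set as `C`. [cite: Borel1963, §5] -/
theorem exists_isAutomorphicMeasure_of_cover_of_center'_eq_bot (𝒢 : AdelicGroupData.{u} K)
    [LocallyCompactSpace 𝒢.Adelic] [SecondCountableTopology 𝒢.Adelic] [T2Space 𝒢.Adelic]
    [MeasurableSpace 𝒢.Adelic] [BorelSpace 𝒢.Adelic]
    (hdisc : 𝒢.IsDiscreteRational) (hc : 𝒢.center' = ⊥)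
    (hmod : ∀ γ ∈ 𝒢.arithmeticSubgroup, modularCharacter γ = 1)
    (ν : Measure 𝒢.Adelic) [ν.IsHaarMeasure] {C : Set 𝒢.Adelic}
    (hcov : 𝒢.toAutomorphicQuotient '' C = Set.univ) (hfin : ν C < ∞) :
    ∃ μ : Measure 𝒢.automorphicQuotient, 𝒢.IsAutomorphicMeasure μ := by
  classical
  have hq : 𝒢.quotientSubgroup = 𝒢.arithmeticSubgroup := by
    rw [AdelicGroupData.quotientSubgroup, hc, bot_sup_eq]
  haveI : DiscreteTopology 𝒢.quotientSubgroup := by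
    rw [hq]
    exact hdisc
  have hmodq : ∀ γ ∈ 𝒢.quotientSubgroup, modularCharacter γ = 1 := fun γ hγ =>
    hmod γ (by rwa [hq] at hγ)
  have hcov' : (QuotientGroup.mk : 𝒢.Adelic → 𝒢.Adelic ⧸ 𝒢.quotientSubgroup) '' C = Set.univ :=
    hcov
  obtain ⟨μ₁, hfin₁, hpos₁, hreg₁, hinv₁⟩ :=
    exists_smulInvariantMeasure_quotient_of_cover 𝒢.quotientSubgroup hmodq ν hcov' hfin
  -- transport to the automorphic quotient (the same coset space with its Borel σ-algebra)
  have hΓc : IsClosed (𝒢.quotientSubgroup : Set 𝒢.Adelic) := Subgroup.isClosed_of_discrete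
  haveI : BorelSpace (𝒢.Adelic ⧸ 𝒢.quotientSubgroup) := borelSpace_quotient _ hΓc
  haveI : T2Space 𝒢.automorphicQuotient :=
    inferInstanceAs (T2Space (𝒢.Adelic ⧸ 𝒢.quotientSubgroup))
  let e : (𝒢.Adelic ⧸ 𝒢.quotientSubgroup) ≃ₜ 𝒢.automorphicQuotient := Homeomorph.refl _
  have hem : Measurable e := e.continuous.measurable
  set μ : Measure 𝒢.automorphicQuotient := μ₁.map e with hμ
  have hμs : ∀ s : Set 𝒢.automorphicQuotient, MeasurableSet s → μ s = μ₁ (e ⁻¹' s) :=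
    fun s hs => by rw [hμ, Measure.map_apply hem hs]
  haveI := hfin₁
  haveI := hpos₁
  haveI := hreg₁
  haveI : IsFiniteMeasure μ := inferInstance
  haveI : μ.IsOpenPosMeasure := e.continuous.isOpenPosMeasure_map e.surjective
  haveI : μ.InnerRegularCompactLTTop :=
    Measure.InnerRegularCompactLTTop.map_of_continuous e.continuous
  haveI : SMulInvariantMeasure 𝒢.Adelic 𝒢.automorphicQuotient μ := by
    refine ⟨fun g s hs => ?_⟩
    have hgs : MeasurableSet ((fun q : 𝒢.automorphicQuotient => g • q) ⁻¹' s) :=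
      measurable_const_smul g hs
    rw [hμs s hs, hμs _ hgs]
    exact hinv₁.measure_preimage_smul g (hem hs)
  exact ⟨μ, {}⟩

/-- **Unimodular variant.** For a datum with `A_G = ⊥`, discrete `G(K)` and UNIMODULAR locally
compact second countable Hausdorff `G(𝔸_K)` (modular function identically `1` — e.g. `G` reductive,
Platonov–Rapinchuk §3.5 / Getz–Hahn Lemma 3.5.4), a set of finite Haar measure meeting every coset of
`G(K)` yields an automorphic measure. [cite: Borel1963, §5] -/
theorem exists_isAutomorphicMeasure_of_cover_of_unimodular (𝒢 : AdelicGroupData.{u} K)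
    [LocallyCompactSpace 𝒢.Adelic] [SecondCountableTopology 𝒢.Adelic] [T2Space 𝒢.Adelic]
    [MeasurableSpace 𝒢.Adelic] [BorelSpace 𝒢.Adelic]
    (hdisc : 𝒢.IsDiscreteRational) (hc : 𝒢.center' = ⊥)
    (hunimod : ∀ g : 𝒢.Adelic, modularCharacter g = 1)
    (ν : Measure 𝒢.Adelic) [ν.IsHaarMeasure] {C : Set 𝒢.Adelic}
    (hcov : 𝒢.toAutomorphicQuotient '' C = Set.univ) (hfin : ν C < ∞) :
    ∃ μ : Measure 𝒢.automorphicQuotient, 𝒢.IsAutomorphicMeasure μ :=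
  exists_isAutomorphicMeasure_of_cover_of_center'_eq_bot 𝒢 hdisc hc (fun γ _ => hunimod γ) ν hcov
    hfin

end AdelicGroupData

/-! ### The unitary group of a matrix over a CM field -/

namespace UnitaryGroup

open Literature.AlgebraicGeometry.ShimuraVarieties (hermForm)

variable (L : Type) [Field L] [NumberField L] [IsCMField L] (N : ℕ) (H : Matrix (Fin N) (Fin N) L)

/-- **Automorphic measure on `U(H)(𝔸_{L⁺}) ⧸ U(H)(L⁺)` from a covering set of finite volume**
(the reduction-theory interface for ISOTROPIC `H`, e.g. the quasi-split `U(Φ_N)`): for any matrix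
`H ∈ M_N(L)` over a CM field `L` — the datum `cmDatum L N H` has `A_G = ⊥` (`cmDatum_center'`) and
discrete rational points (`cmDatum_isDiscreteRational`) — if the modular function of `U(H)(𝔸_{L⁺})`
is trivial on `U(H)(L⁺)` and a set `C` of finite Haar measure (for a Borel structure on
`U(H)(𝔸_{L⁺})`) meets every coset of `U(H)(L⁺)`, then an automorphic measure exists. With `C` a
Siegel set this is Borel (1963) §5 Thm. 5.8 for `U(H)`. [cite: Borel1963, §5]
[cite: PlatonovRapinchuk1994, Thm. 4.17] -/
theorem exists_isAutomorphicMeasure_cmDatum_of_cover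
    [MeasurableSpace (cmDatum L N H).Adelic] [BorelSpace (cmDatum L N H).Adelic]
    (hmod : ∀ γ ∈ (cmDatum L N H).arithmeticSubgroup, modularCharacter γ = 1)
    (ν : Measure (cmDatum L N H).Adelic) [ν.IsHaarMeasure] {C : Set (cmDatum L N H).Adelic}
    (hcov : (cmDatum L N H).toAutomorphicQuotient '' C = Set.univ) (hfin : ν C < ∞) :
    ∃ μ : Measure (cmDatum L N H).automorphicQuotient, (cmDatum L N H).IsAutomorphicMeasure μ :=
  AdelicGroupData.exists_isAutomorphicMeasure_of_cover_of_center'_eq_bot (cmDatum L N H)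
    (cmDatum_isDiscreteRational L N H) (cmDatum_center' L N H) hmod ν hcov hfin

/-- **Unimodular variant for `U(H)`**: if the modular function of `U(H)(𝔸_{L⁺})` is identically `1`
(unitary groups are reductive, hence unimodular — Platonov–Rapinchuk §3.5; Getz–Hahn Lemma 3.5.4),
a set of finite Haar measure meeting every coset of `U(H)(L⁺)` yields an automorphic measure.
[cite: Borel1963, §5] -/
theorem exists_isAutomorphicMeasure_cmDatum_of_cover_of_unimodular
    [MeasurableSpace (cmDatum L N H).Adelic] [BorelSpace (cmDatum L N H).Adelic]
    (hunimod : ∀ g : (cmDatum L N H).Adelic, modularCharacter g = 1)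
    (ν : Measure (cmDatum L N H).Adelic) [ν.IsHaarMeasure] {C : Set (cmDatum L N H).Adelic}
    (hcov : (cmDatum L N H).toAutomorphicQuotient '' C = Set.univ) (hfin : ν C < ∞) :
    ∃ μ : Measure (cmDatum L N H).automorphicQuotient, (cmDatum L N H).IsAutomorphicMeasure μ :=
  exists_isAutomorphicMeasure_cmDatum_of_cover L N H (fun γ _ => hunimod γ) ν hcov hfin

/-! ### Instances needing no reduction theory: `N = 0` and the definite form `1_N` -/

/-- In rank `0` every matrix is (vacuously) anisotropic: `n → L` is a singleton for empty `n`
(private helper). [folklore] -/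
private theorem anisotropic_of_isEmpty {n : Type*} [Fintype n] [IsEmpty n] (H : Matrix n n L) :
    ∀ x : n → L, hermForm (cmConjRingHom L) H x x = 0 → x = 0 :=
  fun x _ => Subsingleton.elim x 0

/-- **Automorphic measure in rank `0`**: for the empty index type the unitary group is trivial, its
automorphic quotient a point; covered by the anisotropic constructor. [cite: Borel1963, §5] -/
theorem exists_isAutomorphicMeasure_cmDatum_zero (H : Matrix (Fin 0) (Fin 0) L) :
    ∃ μ : Measure (cmDatum L 0 H).automorphicQuotient, (cmDatum L 0 H).IsAutomorphicMeasure μ :=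
  exists_isAutomorphicMeasure_cmDatum L 0 H (anisotropic_of_isEmpty L H)

/-- **The identity Gram matrix is anisotropic over a CM field**: `⟪x, x⟫_{1} = Σ x̄ᵢ xᵢ = 0 ⇒ x = 0`,
since `1_N` is positive definite at any complex embedding (`anisotropic_of_posDef_map`); this is the
DEFINITE unitary group `U(N)`, for `N = 1` the group `U(1) = U(Φ₁)` (private helper). [folklore] -/
private theorem anisotropic_one {n : Type*} [Fintype n] [DecidableEq n] :
    ∀ x : n → L, hermForm (cmConjRingHom L) (1 : Matrix n n L) x x = 0 → x = 0 := by
  obtain ⟨τ⟩ := (inferInstance : Nonempty (L →+* ℂ))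
  refine anisotropic_of_posDef_map L (1 : Matrix n n L) τ ?_
  rw [Matrix.map_one τ (map_zero τ) (map_one τ)]
  exact Matrix.PosDef.one

/-- **Automorphic measure for the definite unitary group `U(1_N)`** over a CM field (compact
automorphic quotient; `N = 1`: the anisotropic torus `U(1)_{L/L⁺}`). [cite: Borel1963, §5] -/
theorem exists_isAutomorphicMeasure_cmDatum_one :
    ∃ μ : Measure (cmDatum L N (1 : Matrix (Fin N) (Fin N) L)).automorphicQuotient,
      (cmDatum L N (1 : Matrix (Fin N) (Fin N) L)).IsAutomorphicMeasure μ :=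
  exists_isAutomorphicMeasure_cmDatum L N 1 (anisotropic_one L)

end UnitaryGroup

end Literature.NumberTheory.Automorphic

end
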